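import Mathlib
import Literature.Analysis.Complex.HolomorphicParametricIntegral
import Literature.MathematicalPhysics.QuantumFieldTheory.OSSectorContinuation
import Literature.MathematicalPhysics.QuantumFieldTheory.OSReconstructionNoE1Proofs
import HarnessLib

/-!
# Complex-time matrix elements (stub `stub_complexTimeSlot`, crux `PlanarSpectralCone`)

Line `two-mirror-lightcone-slots` of crux `MirrorModularBoosts.PlanarSpectralCone`
(stmt-QuantumFields-9664), FRONT END, analysis.

Informal statement. Let `T` be a labelled Schwinger family on `ℝ⁴` with reflection positivity
and translation invariance on `⁰𝒮`, `h : OSReconstructionNoE1 T` its Osterwalder–Schrader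
reconstruction (Hilbert space `ℋ`, contraction semigroup `e^{-tH} = h.transfer t`, unitary spatial
translations `U(a⃗) = h.translate a`). For any two vectors `ψ, ψ' ∈ ℋ` the matrix element
`x ↦ ⟪ψ, e^{-xH} U(a⃗) ψ'⟫` (`x > 0`, `a` spatial) is the restriction to the positive real axis of
a function `E a τ` which is holomorphic in `τ` on the right half-plane `Re τ > 0`, continuous in
`a ∈ ℝ⁴` for fixed `τ`, and bounded by one constant `C` (here
`C = (‖ψ+ψ'‖² + ‖ψ−ψ'‖² + ‖ψ+iψ'‖² + ‖ψ−iψ'‖²)/4 = ‖ψ‖² + ‖ψ'‖²`).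

Proof. Polarise over the four vectors `χₖ = ψ + iᵏψ'`: each has a joint spectral measure `μₖ`
of `(H, P⃗)` (`OSReconstructionNoE1.exists_isJointSpectralMeasure_holds`), a finite measure on
`{p₀ ≥ 0}` with `⟪χₖ, e^{-tH}U(a⃗)χₖ⟫ = ∫ e^{−tp₀ + i⟨a,p⟩} dμₖ`. The Laplace–Fourier transform
`gₖ a τ = ∫ e^{−τp₀ + i⟨a,p⟩} dμₖ` has integrand of modulus `e^{−Re τ · p₀} ≤ 1` (`μₖ`-a.e.), so it is
bounded by `μₖ(ℝ⁴) = ‖χₖ‖²`, continuous in `a` (dominated convergence) and holomorphic in `τ` on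
`Re τ > 0` (holomorphic dominated parameter integrals,
`Literature.Analysis.Complex.differentiableOn_integral_of_dominated`). Finally
`E a τ = (g₁ − g₂ − i g₃ + i g₄)/4` and the polarisation identity
`⟪ψ, Aψ'⟫ = (Q(ψ+ψ') − Q(ψ−ψ') − iQ(ψ+iψ') + iQ(ψ−iψ'))/4`, `Q(χ) = ⟪χ, Aχ⟫`, for the linear map
`A = e^{-xH}U(a⃗)`.

References: K. Osterwalder, R. Schrader, Comm. Math. Phys. 31 (1973), §4.1 (the operators
`e^{-tH}`, `U(a⃗)`); M. Reed, B. Simon, Methods of Modern Mathematical Physics I, Thm. VIII.12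
(joint spectral measures); the rest is folklore.
-/

noncomputable section

namespace Summit.QuantumFields.YangMills.Cruxes.PlanarSpectralCone.TwoMirrorLightconeSlots

open MeasureTheory Complex Set Filter
open scoped InnerProductSpace ComplexConjugate
open Literature.MathematicalPhysics.QuantumLattice Literature.MathematicalPhysics.AQFT
  Literature.MathematicalPhysics.QuantumFieldTheory

local notation "E4" => EuclideanSpace ℝ (Fin 4)

/-! ## Polarisation and an elementary norm bound

The helpers live in the sub-namespace `ComplexTimeSlot` (no collisions with sibling stub files). -/

namespace ComplexTimeSlot

/-- **Polarisation identity, operator in the second slot**: for a `ℂ`-linear map `A` (Mathlib's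
inner product is conjugate-linear in the first variable),
`⟪x, A y⟫ = (Q(x+y) − Q(x−y) − i Q(x+iy) + i Q(x−iy))/4` with `Q(χ) = ⟪χ, Aχ⟫`. -/
theorem inner_map_polarization_right {V : Type*} [NormedAddCommGroup V] [InnerProductSpace ℂ V]
    (A : V →ₗ[ℂ] V) (x y : V) :
    ⟪x, A y⟫_ℂ =
      (⟪x + y, A (x + y)⟫_ℂ - ⟪x - y, A (x - y)⟫_ℂ - I * ⟪x + I • y, A (x + I • y)⟫_ℂ +
        I * ⟪x - I • y, A (x - I • y)⟫_ℂ) / 4 := by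
  simp only [map_add, map_sub, map_smul, inner_add_left, inner_add_right, inner_sub_left,
    inner_sub_right, inner_smul_left, inner_smul_right, Complex.conj_I]
  linear_combination ((⟪x, A y⟫_ℂ - ⟪y, A x⟫_ℂ) / 2) * Complex.I_sq

/-- The polarisation combination `(u − v − i w + i z)/4` is bounded by the mean of bounds of its
four entries. -/
theorem norm_polarComb_le {u v w z : ℂ} {A B C D : ℝ} (hu : ‖u‖ ≤ A) (hv : ‖v‖ ≤ B)
    (hw : ‖w‖ ≤ C) (hz : ‖z‖ ≤ D) :
    ‖(u - v - I * w + I * z) / 4‖ ≤ (A + B + C + D) / 4 := by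
  have h1 := norm_add_le (u - v - I * w) (I * z)
  have h2 := norm_sub_le (u - v) (I * w)
  have h3 := norm_sub_le u v
  rw [norm_mul, Complex.norm_I, one_mul] at h1 h2
  rw [norm_div, show ‖(4 : ℂ)‖ = 4 by norm_num]
  linarith

/-! ## The Laplace–Fourier transform of a finite measure on `{p₀ ≥ 0}` -/

/-- Modulus of the Laplace–Fourier kernel: `|e^{−τp₀ + i⟨a,p⟩}| = e^{−Re τ · p₀}`. -/
theorem norm_lfKernel (τ : ℂ) (a p : E4) :
    ‖cexp (-(τ * ((p 0 : ℝ) : ℂ)) + ((⟪a, p⟫_ℝ : ℝ) : ℂ) * I)‖ = Real.exp (-(τ.re * p 0)) := by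
  rw [Complex.norm_exp]
  congr 1
  simp

/-- On `{Re τ ≥ 0} × {p₀ ≥ 0}` the Laplace–Fourier kernel has modulus `≤ 1`. -/
theorem norm_lfKernel_le_one {τ : ℂ} (hτ : 0 ≤ τ.re) (a : E4) {p : E4} (hp : 0 ≤ p 0) :
    ‖cexp (-(τ * ((p 0 : ℝ) : ℂ)) + ((⟪a, p⟫_ℝ : ℝ) : ℂ) * I)‖ ≤ 1 := by
  rw [norm_lfKernel, Real.exp_le_one_iff, neg_nonpos]
  exact mul_nonneg hτ hp

/-- The Laplace–Fourier kernel is continuous in the momentum `p`. -/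
theorem continuous_lfKernel_momentum (τ : ℂ) (a : E4) :
    Continuous fun p : E4 => cexp (-(τ * ((p 0 : ℝ) : ℂ)) + ((⟪a, p⟫_ℝ : ℝ) : ℂ) * I) := by
  fun_prop

/-- The Laplace–Fourier kernel is continuous in the shift `a`. -/
theorem continuous_lfKernel_shift (τ : ℂ) (p : E4) :
    Continuous fun a : E4 => cexp (-(τ * ((p 0 : ℝ) : ℂ)) + ((⟪a, p⟫_ℝ : ℝ) : ℂ) * I) := by
  fun_prop

/-- The Laplace–Fourier kernel is entire in the complex time `τ`. -/
theorem differentiable_lfKernel_time (a p : E4) :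
    Differentiable ℂ fun τ : ℂ => cexp (-(τ * ((p 0 : ℝ) : ℂ)) + ((⟪a, p⟫_ℝ : ℝ) : ℂ) * I) := by
  fun_prop

/-- A ball of radius `Re τ₀` around a point `τ₀` of the right half-plane stays in the right
half-plane. -/
theorem re_pos_of_mem_ball {τ₀ τ : ℂ} (hτ : τ ∈ Metric.ball τ₀ τ₀.re) : 0 < τ.re := by
  rw [Metric.mem_ball, dist_eq_norm] at hτ
  have h1 := abs_re_le_norm (τ - τ₀)
  rw [Complex.sub_re] at h1
  have h2 := (abs_lt.1 (h1.trans_lt hτ)).1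
  linarith

/-- **The Laplace–Fourier transform of a finite measure carried by `{p₀ ≥ 0}`.** For a finite
measure `μ` on energy–momentum space `ℝ⁴` with `μ{p₀ < 0} = 0` there is a function `g a τ`
(namely `∫ e^{−τp₀ + i⟨a,p⟩} dμ`) which is holomorphic in `τ` on `Re τ > 0`, continuous in `a` for
`Re τ > 0`, bounded there by the total mass `μ(ℝ⁴)`, and given at real `τ = x > 0` by the
Laplace–Fourier integral in the normal form of `IsJointSpectralMeasure.inner_transfer_translate`. -/
theorem exists_laplaceFourier (μ : Measure E4) [IsFiniteMeasure μ] (hE : μ {p | p 0 < 0} = 0) :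
    ∃ g : E4 → ℂ → ℂ,
      (∀ a : E4, DifferentiableOn ℂ (g a) {τ : ℂ | 0 < τ.re}) ∧
      (∀ τ : ℂ, 0 < τ.re → Continuous fun a : E4 => g a τ) ∧
      (∀ (a : E4) (τ : ℂ), 0 < τ.re → ‖g a τ‖ ≤ μ.real Set.univ) ∧
      (∀ (a : E4) (x : ℝ), 0 < x →
        g a x = ∫ p, cexp (((-(x * p 0) : ℝ) : ℂ) + ((⟪a, p⟫_ℝ : ℝ) : ℂ) * I) ∂μ) := by
  have hae : ∀ᵐ p ∂μ, 0 ≤ p 0 := by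
    rw [ae_iff]
    simpa only [not_le] using hE
  refine ⟨fun a τ => ∫ p, cexp (-(τ * ((p 0 : ℝ) : ℂ)) + ((⟪a, p⟫_ℝ : ℝ) : ℂ) * I) ∂μ,
    fun a => ?_, fun τ hτ => ?_, fun a τ hτ => ?_, fun a x hx => ?_⟩
  · -- holomorphy in `τ`: a dominated holomorphic parameter integral
    refine Literature.Analysis.Complex.differentiableOn_integral_of_dominated
      (fun τ _ => (continuous_lfKernel_momentum τ a).aestronglyMeasurable)
      (Eventually.of_forall fun p => (differentiable_lfKernel_time a p).differentiableOn)
      fun τ₀ hτ₀ => ?_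
    refine ⟨τ₀.re, hτ₀, fun τ hτ => re_pos_of_mem_ball hτ, fun _ => 1, integrable_const _, ?_⟩
    filter_upwards [hae] with p hp
    intro τ hτ
    exact norm_lfKernel_le_one (re_pos_of_mem_ball hτ).le a hp
  · -- continuity in `a`: dominated convergence
    exact continuous_of_dominated (fun a => (continuous_lfKernel_momentum τ a).aestronglyMeasurable)
      (fun a => by
        filter_upwards [hae] with p hp using norm_lfKernel_le_one hτ.le a hp)
      (integrable_const (1 : ℝ)) (ae_of_all _ fun p => continuous_lfKernel_shift τ p)
  · -- the uniform bound
    calc ‖∫ p, cexp (-(τ * ((p 0 : ℝ) : ℂ)) + ((⟪a, p⟫_ℝ : ℝ) : ℂ) * I) ∂μ‖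
        ≤ 1 * μ.real Set.univ := norm_integral_le_of_norm_le_const (by
          filter_upwards [hae] with p hp using norm_lfKernel_le_one hτ.le a hp)
      _ = μ.real Set.univ := one_mul _
  · -- real points
    show ∫ p, cexp (-((x : ℂ) * ((p 0 : ℝ) : ℂ)) + ((⟪a, p⟫_ℝ : ℝ) : ℂ) * I) ∂μ = _
    refine integral_congr_ae (ae_of_all _ fun p => ?_)
    push_cast
    ring_nf

/-- Polarisation of the matrix elements of `e^{-xH} U(a⃗)` on the OS Hilbert space:
`⟪ψ, e^{-xH}U(a⃗)ψ'⟫ = (Q(ψ+ψ') − Q(ψ−ψ') − iQ(ψ+iψ') + iQ(ψ−iψ'))/4`, `Q(χ) = ⟪χ, e^{-xH}U(a⃗)χ⟫`. -/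
theorem inner_transfer_translate_polarization
    {ι : Type} {T : LabelledSchwingerFamily ι E4} (h : OSReconstructionNoE1 T) (x : ℝ) (a : E4)
    (ψ ψ' : h.Hilbert) :
    ⟪ψ, h.transfer x (h.translate a ψ')⟫_ℂ =
      (⟪ψ + ψ', h.transfer x (h.translate a (ψ + ψ'))⟫_ℂ
        - ⟪ψ - ψ', h.transfer x (h.translate a (ψ - ψ'))⟫_ℂ
        - I * ⟪ψ + I • ψ', h.transfer x (h.translate a (ψ + I • ψ'))⟫_ℂ
        + I * ⟪ψ - I • ψ', h.transfer x (h.translate a (ψ - I • ψ'))⟫_ℂ) / 4 :=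
  inner_map_polarization_right
    ((h.transfer x : h.Hilbert →ₗ[ℂ] h.Hilbert) ∘ₗ (h.translate a).toLinearEquiv.toLinearMap) ψ ψ'

end ComplexTimeSlot

/-! ## The stub -/

/-- **FRONT END, analysis — complex-time matrix elements.** For ANY labelled family `T` on `ℝ⁴`
with E2 + translations on `⁰𝒮` (`h : OSReconstructionNoE1 T`) and vectors `ψ, ψ'`, the matrix
element `⟪ψ, e^{-xH} U(a⃗) ψ'⟫` (`x > 0`, `a` spatial) is the restriction to the positive axis of a
function `E a τ` holomorphic in `τ` on the right half-plane, continuous in `a ∈ ℝ⁴`, and bounded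
by one constant. Proof: polarise over `χₖ = ψ + iᵏψ'` and take
`E a τ = ¼ Σₖ (−i)ᵏ ∫ e^{−τ p₀ + i⟨a,p⟩} dμₖ` with `μₖ` a joint spectral measure of `χₖ`
(`exists_isJointSpectralMeasure_holds`); `exists_laplaceFourier` supplies holomorphy, continuity
and the bound `‖χₖ‖²`, `IsJointSpectralMeasure.inner_transfer_translate` the real points. -/
theorem stub_complexTimeSlot
    {ι : Type} {T : LabelledSchwingerFamily ι E4} (h : OSReconstructionNoE1 T) (ψ ψ' : h.Hilbert) :
    ∃ (C : ℝ) (E : E4 → ℂ → ℂ),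
      (∀ a : E4, DifferentiableOn ℂ (E a) {τ : ℂ | 0 < τ.re}) ∧
      (∀ τ : ℂ, 0 < τ.re → Continuous fun a : E4 => E a τ) ∧
      (∀ (a : E4) (τ : ℂ), 0 < τ.re → ‖E a τ‖ ≤ C) ∧
      (∀ a : E4, a 0 = 0 → ∀ x : ℝ, 0 < x →
        E a (x : ℂ) = ⟪ψ, h.transfer x (h.translate a ψ')⟫_ℂ) := by
  obtain ⟨μ₁, hμ₁⟩ := OSReconstructionNoE1.exists_isJointSpectralMeasure_holds h (ψ + ψ')
  obtain ⟨μ₂, hμ₂⟩ := OSReconstructionNoE1.exists_isJointSpectralMeasure_holds h (ψ - ψ')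
  obtain ⟨μ₃, hμ₃⟩ := OSReconstructionNoE1.exists_isJointSpectralMeasure_holds h (ψ + I • ψ')
  obtain ⟨μ₄, hμ₄⟩ := OSReconstructionNoE1.exists_isJointSpectralMeasure_holds h (ψ - I • ψ')
  haveI := hμ₁.isFiniteMeasure
  haveI := hμ₂.isFiniteMeasure
  haveI := hμ₃.isFiniteMeasure
  haveI := hμ₄.isFiniteMeasure
  obtain ⟨g₁, hd₁, hc₁, hb₁, hr₁⟩ := ComplexTimeSlot.exists_laplaceFourier μ₁ hμ₁.energy_nonneg
  obtain ⟨g₂, hd₂, hc₂, hb₂, hr₂⟩ := ComplexTimeSlot.exists_laplaceFourier μ₂ hμ₂.energy_nonneg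
  obtain ⟨g₃, hd₃, hc₃, hb₃, hr₃⟩ := ComplexTimeSlot.exists_laplaceFourier μ₃ hμ₃.energy_nonneg
  obtain ⟨g₄, hd₄, hc₄, hb₄, hr₄⟩ := ComplexTimeSlot.exists_laplaceFourier μ₄ hμ₄.energy_nonneg
  refine ⟨(‖ψ + ψ'‖ ^ 2 + ‖ψ - ψ'‖ ^ 2 + ‖ψ + I • ψ'‖ ^ 2 + ‖ψ - I • ψ'‖ ^ 2) / 4,
    fun a τ => (g₁ a τ - g₂ a τ - I * g₃ a τ + I * g₄ a τ) / 4,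
    fun a => ?_, fun τ hτ => ?_, fun a τ hτ => ?_, fun a ha x hx => ?_⟩
  · exact ((((hd₁ a).sub (hd₂ a)).sub ((hd₃ a).const_mul I)).add ((hd₄ a).const_mul I)).div_const 4
  · exact ((((hc₁ τ hτ).sub (hc₂ τ hτ)).sub (continuous_const.mul (hc₃ τ hτ))).add
      (continuous_const.mul (hc₄ τ hτ))).div_const 4
  · rw [← hμ₁.measureReal_univ, ← hμ₂.measureReal_univ, ← hμ₃.measureReal_univ,
      ← hμ₄.measureReal_univ]
    exact ComplexTimeSlot.norm_polarComb_le (hb₁ a τ hτ) (hb₂ a τ hτ) (hb₃ a τ hτ) (hb₄ a τ hτ)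
  · show (g₁ a x - g₂ a x - I * g₃ a x + I * g₄ a x) / 4 = _
    rw [hr₁ a x hx, hr₂ a x hx, hr₃ a x hx, hr₄ a x hx,
      ← hμ₁.inner_transfer_translate x hx.le a ha, ← hμ₂.inner_transfer_translate x hx.le a ha,
      ← hμ₃.inner_transfer_translate x hx.le a ha, ← hμ₄.inner_transfer_translate x hx.le a ha]
    exact (ComplexTimeSlot.inner_transfer_translate_polarization h x a ψ ψ').symm

end Summit.QuantumFields.YangMills.Cruxes.PlanarSpectralCone.TwoMirrorLightconeSlots
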